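import Literature.Geometry.Riemannian.ParabolicReGraph
import Mathlib.Analysis.Calculus.InverseFunctionTheorem.ContDiff
import HarnessLib

/-!
# Re-graphing a parabolic graph over a nearby frame: regularity of the new graph function

Topic `Literature/Geometry/Riemannian`; continuation of `ParabolicReGraph.lean`.  The slice-wise
inverse `χ` of `Ψ (x, t) = (Φ_t x, t)` produced there is as smooth as `Φ` (jointly in `(ξ, t)`):
`Ψ` is injective on the region, and at every point its derivative
`(h, τ) ↦ (D_xΦ h + ∂ₜΦ τ, τ)` is invertible because `D_xΦ` is (`sliceEquiv`), so the local
inverses given by the inverse function theorem are restrictions of the global one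
(`contDiffAt_of_left_inverse`, `contDiffAt_sliceInverse`).  Consequently the re-graphed function
`u' = Q ∘ (L χ + u ∘ (χ, t))` is `Cⁿ` when `u` is, and satisfies the regularity guard `IsC21On`
(`isC21On_of_contDiffOn`).

Everything is PROVED; no definitions, no named facts.

## References

* B. White, *A local regularity theorem for mean curvature flow*, Ann. of Math. 161 (2005), §2.5,
  p. 1499. [White2005]
-/

noncomputable section

open scoped Topology InnerProductSpace NNReal
open Filter

namespace Literature.Geometry.Riemannian

open Literature.Analysis.PDE Literature.Analysis.PDE.Parabolic Metric Set

namespace ParabolicFlow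

/-! ### Left inverses inherit smoothness (inverse function theorem) -/

section LeftInverse

variable {E F : Type*} [NormedAddCommGroup E] [NormedSpace ℝ E] [CompleteSpace E]
  [NormedAddCommGroup F] [NormedSpace ℝ F]

/-- A left inverse `g` of `f` near `a` is `Cⁿ` at `f a` when `f` is `Cⁿ` at `a` with invertible
derivative (`n ≠ 0`). [folklore] -/
theorem contDiffAt_of_left_inverse {f : E → F} {g : F → E} {f' : E ≃L[ℝ] F} {a : E}
    {n : WithTop ℕ∞} (hf : ContDiffAt ℝ n f a) (hf' : HasFDerivAt f (f' : E →L[ℝ] F) a)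
    (hn : n ≠ 0) (hg : ∀ᶠ x in 𝓝 a, g (f x) = x) : ContDiffAt ℝ n g (f a) :=
  (hf.to_localInverse hf' hn).congr_of_eventuallyEq
    ((hf.hasStrictFDerivAt' hf' hn).localInverse_unique hg)

end LeftInverse

/-! ### The derivative of `Ψ (x, t) = (Φ (x, t), t)` is invertible when `D_x Φ` is -/

section SliceEquiv

variable {E : Type*} [NormedAddCommGroup E] [NormedSpace ℝ E]

/-- The block-triangular isomorphism `(h, τ) ↦ (B (h, τ), τ)` of `E × ℝ` built from
`B : E × ℝ → E` whose restriction `A = B ∘ inl` to `E` is invertible; inverse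
`(k, σ) ↦ (A⁻¹ (k - B (0, σ)), σ)`. [folklore] -/
theorem exists_sliceEquiv (B : E × ℝ →L[ℝ] E) (A : E ≃L[ℝ] E)
    (hA : (A : E →L[ℝ] E) = B.comp (ContinuousLinearMap.inl ℝ E ℝ)) :
    ∃ Ψ' : (E × ℝ) ≃L[ℝ] (E × ℝ),
      (Ψ' : E × ℝ →L[ℝ] E × ℝ) = B.prod (ContinuousLinearMap.snd ℝ E ℝ) := by
  have hAB : ∀ h : E, A h = B (h, 0) := fun h => by
    rw [show A h = (A : E →L[ℝ] E) h from rfl, hA]; rfl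
  have hsplit : ∀ (h : E) (τ : ℝ), B (h, τ) = B (h, 0) + B (0, τ) := fun h τ => by
    rw [← map_add]; simp
  set M : E × ℝ →L[ℝ] E × ℝ := B.prod (ContinuousLinearMap.snd ℝ E ℝ) with hM
  set M' : E × ℝ →L[ℝ] E × ℝ :=
    ((A.symm : E →L[ℝ] E).comp (ContinuousLinearMap.fst ℝ E ℝ -
      B.comp ((ContinuousLinearMap.inr ℝ E ℝ).comp (ContinuousLinearMap.snd ℝ E ℝ)))).prod
      (ContinuousLinearMap.snd ℝ E ℝ) with hM'
  have h1 : ∀ p, M' (M p) = p := by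
    rintro ⟨h, τ⟩
    simp only [hM, hM', ContinuousLinearMap.prod_apply, ContinuousLinearMap.coe_snd',
      ContinuousLinearMap.coe_comp, Function.comp_apply, sub_apply,
      ContinuousLinearMap.coe_fst', ContinuousLinearMap.inr_apply, Prod.mk.injEq, and_true]
    rw [hsplit h τ, add_sub_cancel_right, ← hAB]
    exact A.symm_apply_apply h
  have h2 : ∀ q, M (M' q) = q := by
    rintro ⟨k, σ⟩
    simp only [hM, hM', ContinuousLinearMap.prod_apply, ContinuousLinearMap.coe_snd',
      ContinuousLinearMap.coe_comp, Function.comp_apply, sub_apply,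
      ContinuousLinearMap.coe_fst', ContinuousLinearMap.inr_apply, Prod.mk.injEq, and_true]
    rw [hsplit, ← hAB]
    rw [show A ((A.symm : E →L[ℝ] E) (k - B (0, σ))) = A (A.symm (k - B (0, σ))) from rfl,
      A.apply_symm_apply, sub_add_cancel]
  exact ⟨ContinuousLinearEquiv.equivOfInverse M M' h1 h2, rfl⟩

end SliceEquiv

/-! ### Smoothness of the slice-wise inverse -/

section SliceInverse

variable {E : Type*} [NormedAddCommGroup E] [NormedSpace ℝ E] [CompleteSpace E]

/-- **Slice-wise inverses are smooth.**  Let `Φ : E × ℝ → E` be `Cⁿ` on the open set `U` with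
`D_xΦ` invertible there, and let `χ` be a two-sided inverse of the slices: `χ (Φ p, t) = x` for
`p = (x, t) ∈ U`, and `(χ q, σ) ∈ U`, `Φ (χ q, σ) = ξ` for `q = (ξ, σ)` in the open set `V`.  Then
`χ` is `Cⁿ` on `V`. [folklore] -/
theorem contDiffAt_sliceInverse {n : WithTop ℕ∞} (hn : n ≠ 0) {Φ χ : E × ℝ → E} {U V : Set (E × ℝ)}
    (hU : IsOpen U) (hΦ : ContDiffOn ℝ n Φ U)
    (hleft : ∀ p ∈ U, χ (Φ p, p.2) = p.1)
    (hright : ∀ q ∈ V, (χ q, q.2) ∈ U ∧ Φ (χ q, q.2) = q.1)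
    (hinv : ∀ p ∈ U, ∃ A : E ≃L[ℝ] E,
      (A : E →L[ℝ] E) = (fderiv ℝ Φ p).comp (ContinuousLinearMap.inl ℝ E ℝ))
    {q : E × ℝ} (hq : q ∈ V) : ContDiffAt ℝ n χ q := by
  obtain ⟨hpU, hΦp⟩ := hright q hq
  set p : E × ℝ := (χ q, q.2) with hp
  set Ψ : E × ℝ → E × ℝ := fun p' => (Φ p', p'.2) with hΨ
  have hΦat : ContDiffAt ℝ n Φ p := hΦ.contDiffAt (hU.mem_nhds hpU)
  have hΨat : ContDiffAt ℝ n Ψ p := hΦat.prodMk contDiffAt_snd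
  obtain ⟨A, hA⟩ := hinv p hpU
  obtain ⟨Ψ', hΨ'⟩ := exists_sliceEquiv (fderiv ℝ Φ p) A hA
  have hderiv : HasFDerivAt Ψ (Ψ' : E × ℝ →L[ℝ] E × ℝ) p := by
    rw [hΨ']
    exact (hΦat.differentiableAt hn).hasFDerivAt.prodMk
      (hasFDerivAt_snd (𝕜 := ℝ) (E := E) (F := ℝ))
  -- the global slice-wise inverse is a left inverse of `Ψ` near `p`
  have hg : ∀ᶠ p' in 𝓝 p, (fun q' : E × ℝ => (χ q', q'.2)) (Ψ p') = p' := by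
    filter_upwards [hU.mem_nhds hpU] with p' hp'
    simp only [hΨ, hleft p' hp']
  have hΨp : Ψ p = q := by
    simp only [hΨ]
    exact Prod.ext hΦp rfl
  have hsmooth : ContDiffAt ℝ n (fun q' : E × ℝ => (χ q', q'.2)) q := by
    rw [← hΨp]
    exact contDiffAt_of_left_inverse hΨat hderiv hn hg
  exact contDiffAt_fst.comp q hsmooth

end SliceInverse

/-! ### The guard `IsC21On` from joint smoothness -/

section Guard

variable {E F : Type*} [NormedAddCommGroup E] [NormedSpace ℝ E] [NormedAddCommGroup F]
  [NormedSpace ℝ F]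

/-- The spatial derivative is the joint derivative composed with `inl`, at points of joint
differentiability. [folklore] -/
theorem spaceDeriv_eq_fderiv_comp_inl {u : Parabolic E → F} {x : E} {t : ℝ}
    (h : DifferentiableAt ℝ (fun p : E × ℝ => u ⟨p.1, p.2⟩) (x, t)) :
    spaceDeriv u ⟨x, t⟩ =
      (fderiv ℝ (fun p : E × ℝ => u ⟨p.1, p.2⟩) (x, t)).comp (ContinuousLinearMap.inl ℝ E ℝ) := by
  have hin : HasFDerivAt (fun x' : E => (x', t)) (ContinuousLinearMap.inl ℝ E ℝ) x :=
    (hasFDerivAt_id x).prodMk (hasFDerivAt_const t x)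
  have hcomp := h.hasFDerivAt.comp x hin
  exact hcomp.fderiv

/-- **Joint `C²` functions satisfy the guard**: if `(x, t) ↦ u (x, t)` is `C²` on an open set `U`
of `E × ℝ`, then `IsC21On u {X | (X.x, X.t) ∈ U}`. [cite: White2005, §8 p. 1515] -/
theorem isC21On_of_contDiffOn {u : Parabolic E → F} {U : Set (E × ℝ)} (hU : IsOpen U)
    {n : WithTop ℕ∞} (hn : 2 ≤ n) (hu : ContDiffOn ℝ n (fun p : E × ℝ => u ⟨p.1, p.2⟩) U) :
    IsC21On u {X | (X.x, X.t) ∈ U} := by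
  have h1 : n ≠ 0 := by
    rintro rfl
    exact absurd hn (by norm_num)
  refine ⟨fun X hX => (hu.contDiffAt (hU.mem_nhds hX)).differentiableAt h1, fun X hX => ?_⟩
  -- `x ↦ D u (x, t)` agrees near `X.x` with `x ↦ (fderiv ũ (x, t)) ∘ inl`, which is differentiable
  have hslice : IsOpen {x : E | (x, X.t) ∈ U} :=
    hU.preimage (continuous_id.prodMk continuous_const)
  have hev : (fun x => spaceDeriv u ⟨x, X.t⟩) =ᶠ[𝓝 X.x]
      fun x => (fderiv ℝ (fun p : E × ℝ => u ⟨p.1, p.2⟩) (x, X.t)).comp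
        (ContinuousLinearMap.inl ℝ E ℝ) := by
    filter_upwards [hslice.mem_nhds (show X.x ∈ {x : E | (x, X.t) ∈ U} from hX)] with x hx
    exact spaceDeriv_eq_fderiv_comp_inl ((hu.contDiffAt (hU.mem_nhds hx)).differentiableAt h1)
  refine (DifferentiableAt.congr_of_eventuallyEq ?_ hev)
  have hD : DifferentiableAt ℝ (fderiv ℝ (fun p : E × ℝ => u ⟨p.1, p.2⟩)) (X.x, X.t) := by
    have h2 : ContDiffAt ℝ n (fun p : E × ℝ => u ⟨p.1, p.2⟩) (X.x, X.t) :=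
      hu.contDiffAt (hU.mem_nhds hX)
    exact (h2.fderiv_right (m := 1) (by
      calc (1 : WithTop ℕ∞) + 1 = 2 := by norm_num
        _ ≤ n := hn)).differentiableAt one_ne_zero
  have hin : DifferentiableAt ℝ (fun x : E => (x, X.t)) X.x :=
    differentiableAt_id.prodMk (differentiableAt_const _)
  exact ((ContinuousLinearMap.compL ℝ E (E × ℝ) F).flip
    (ContinuousLinearMap.inl ℝ E ℝ)).differentiableAt.comp X.x (hD.comp X.x hin)

end Guard

/-! ### Perturbations of a linear isomorphism are injective -/

section Perturb

variable {E : Type*} [NormedAddCommGroup E] [NormedSpace ℝ E]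

/-- `‖D - T‖ ≤ δ < ‖T⁻¹‖⁻¹` gives the lower bound `(‖T⁻¹‖⁻¹ - δ) ‖h‖ ≤ ‖D h‖`. [folklore] -/
theorem norm_apply_ge_of_norm_sub_le (T : E ≃L[ℝ] E) (D : E →L[ℝ] E) {δ : ℝ≥0}
    (hD : ‖D - (T : E →L[ℝ] E)‖ ≤ δ)
    (hδ : δ < ‖(T.symm : E →L[ℝ] E)‖₊⁻¹) (h : E) :
    (((‖(T.symm : E →L[ℝ] E)‖₊ : ℝ))⁻¹ - δ) * ‖h‖ ≤ ‖D h‖ := by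
  have hN0 : 0 < ‖(T.symm : E →L[ℝ] E)‖₊ := by
    by_contra h0
    rw [not_lt, nonpos_iff_eq_zero] at h0
    rw [h0, inv_zero] at hδ
    exact absurd hδ (not_lt.2 (by positivity))
  have hN : (0 : ℝ) < ‖(T.symm : E →L[ℝ] E)‖ := hN0
  have h1 : ‖h‖ ≤ ‖(T.symm : E →L[ℝ] E)‖ * ‖T h‖ := by
    calc ‖h‖ = ‖(T.symm : E →L[ℝ] E) (T h)‖ := by simp
      _ ≤ ‖(T.symm : E →L[ℝ] E)‖ * ‖T h‖ := ContinuousLinearMap.le_opNorm _ _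
  have h2 : ‖(D - (T : E →L[ℝ] E)) h‖ ≤ δ * ‖h‖ :=
    (ContinuousLinearMap.le_opNorm _ _).trans (mul_le_mul_of_nonneg_right hD (norm_nonneg _))
  have h3 : ‖T h‖ ≤ ‖D h‖ + ‖(D - (T : E →L[ℝ] E)) h‖ := by
    have : (T h : E) = D h - (D - (T : E →L[ℝ] E)) h := by simp
    rw [this]
    exact norm_sub_le _ _
  have h4 : (‖(T.symm : E →L[ℝ] E)‖)⁻¹ * ‖h‖ ≤ ‖T h‖ := by
    rw [inv_mul_le_iff₀ hN]
    exact h1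
  have : ((‖(T.symm : E →L[ℝ] E)‖₊ : ℝ)) = ‖(T.symm : E →L[ℝ] E)‖ := rfl
  rw [this]
  nlinarith

/-- Hence `D` is injective. [folklore] -/
theorem injective_of_norm_sub_le (T : E ≃L[ℝ] E) (D : E →L[ℝ] E) {δ : ℝ≥0}
    (hD : ‖D - (T : E →L[ℝ] E)‖ ≤ δ) (hδ : δ < ‖(T.symm : E →L[ℝ] E)‖₊⁻¹) :
    Function.Injective D := by
  refine (injective_iff_map_eq_zero _).2 fun h hh => ?_
  have h1 := norm_apply_ge_of_norm_sub_le T D hD hδ h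
  rw [hh, norm_zero] at h1
  have hpos : (0 : ℝ) < ((‖(T.symm : E →L[ℝ] E)‖₊ : ℝ))⁻¹ - δ := by
    have := NNReal.coe_lt_coe.2 hδ
    rw [NNReal.coe_inv] at this
    linarith
  have : ‖h‖ ≤ 0 := by
    by_contra hne
    exact absurd h1 (not_le.2 (mul_pos hpos (lt_of_not_ge hne)))
  exact norm_le_zero_iff.1 this

end Perturb

/-! ### The re-graphed function is smooth -/

section Smooth

variable {N m : ℕ}

/-- **Re-graphing over a nearby frame, with regularity.**  Under the hypotheses of
`exists_regraph` in derivative form (`‖L'† ∘ (L + D u(x,t)) - T‖ ≤ δ < ‖T⁻¹‖⁻¹` on `B_R × I`, `I`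
open) and joint smoothness `u ∈ Cⁿ` (`2 ≤ n`), the slice-wise inverse `χ` and the new graph
function `u'` over `L'` are `Cⁿ` on `V = {(ξ, t) : t ∈ I, ξ ∈ B(Φ_t 0, (‖T⁻¹‖⁻¹ - δ) R')}`.
[cite: White2005, §2.5, p. 1499] -/
theorem exists_regraph_contDiff (L L' : EuclideanSpace ℝ (Fin m) →ₗᵢ[ℝ] EuclideanSpace ℝ (Fin N))
    (u : Parabolic (EuclideanSpace ℝ (Fin m)) → EuclideanSpace ℝ (Fin N))
    (T : EuclideanSpace ℝ (Fin m) ≃L[ℝ] EuclideanSpace ℝ (Fin m)) {δ : ℝ≥0}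
    (hδ : δ < ‖(T.symm : EuclideanSpace ℝ (Fin m) →L[ℝ] EuclideanSpace ℝ (Fin m))‖₊⁻¹)
    {R R' : ℝ} (hR' : 0 ≤ R') (hRR' : R' < R) {I : Set ℝ} (hI : IsOpen I) {n : WithTop ℕ∞}
    (hn : 2 ≤ n)
    (hu : ContDiffOn ℝ n (fun p : EuclideanSpace ℝ (Fin m) × ℝ => u ⟨p.1, p.2⟩)
      {p | p.1 ∈ ball 0 R ∧ p.2 ∈ I})
    (hδ' : ∀ t ∈ I, ∀ x ∈ ball (0 : EuclideanSpace ℝ (Fin m)) R,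
      ‖L'.toContinuousLinearMap.adjoint.comp (L.toContinuousLinearMap + spaceDeriv u ⟨x, t⟩) -
        (T : EuclideanSpace ℝ (Fin m) →L[ℝ] EuclideanSpace ℝ (Fin m))‖ ≤ δ) :
    ∃ χ : Parabolic (EuclideanSpace ℝ (Fin m)) → EuclideanSpace ℝ (Fin m),
    ∃ u' : Parabolic (EuclideanSpace ℝ (Fin m)) → EuclideanSpace ℝ (Fin N),
      (∀ Ξ η, ⟪u' Ξ, L' η⟫_ℝ = 0) ∧
      (∀ Ξ, u' Ξ = (L (χ Ξ) + u ⟨χ Ξ, Ξ.t⟩) -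
        L' (L'.toContinuousLinearMap.adjoint (L (χ Ξ) + u ⟨χ Ξ, Ξ.t⟩))) ∧
      (∀ t ∈ I, ∀ x ∈ ball (0 : EuclideanSpace ℝ (Fin m)) R,
        χ ⟨L'.toContinuousLinearMap.adjoint (L x + u ⟨x, t⟩), t⟩ = x) ∧
      (∀ t ∈ I, ∀ ξ ∈ closedBall (L'.toContinuousLinearMap.adjoint (L 0 + u ⟨0, t⟩))
          (((‖(T.symm : EuclideanSpace ℝ (Fin m) →L[ℝ] EuclideanSpace ℝ (Fin m))‖₊ : ℝ)⁻¹ - δ) *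
            R'),
        χ ⟨ξ, t⟩ ∈ ball (0 : EuclideanSpace ℝ (Fin m)) R ∧
        L'.toContinuousLinearMap.adjoint (L (χ ⟨ξ, t⟩) + u ⟨χ ⟨ξ, t⟩, t⟩) = ξ) ∧
      (∀ t ∈ I, ∀ x ∈ ball (0 : EuclideanSpace ℝ (Fin m)) R,
        (⟨L x + u ⟨x, t⟩, t⟩ : Parabolic (EuclideanSpace ℝ (Fin N))) =
          ⟨L' (L'.toContinuousLinearMap.adjoint (L x + u ⟨x, t⟩)) +
            u' ⟨L'.toContinuousLinearMap.adjoint (L x + u ⟨x, t⟩), t⟩, t⟩) ∧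
      ContDiffOn ℝ n (fun q : EuclideanSpace ℝ (Fin m) × ℝ => χ ⟨q.1, q.2⟩)
        {q | q.2 ∈ I ∧ q.1 ∈ ball (L'.toContinuousLinearMap.adjoint (L 0 + u ⟨0, q.2⟩))
          (((‖(T.symm : EuclideanSpace ℝ (Fin m) →L[ℝ] EuclideanSpace ℝ (Fin m))‖₊ : ℝ)⁻¹ - δ) *
            R')} ∧
      ContDiffOn ℝ n (fun q : EuclideanSpace ℝ (Fin m) × ℝ => u' ⟨q.1, q.2⟩)
        {q | q.2 ∈ I ∧ q.1 ∈ ball (L'.toContinuousLinearMap.adjoint (L 0 + u ⟨0, q.2⟩))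
          (((‖(T.symm : EuclideanSpace ℝ (Fin m) →L[ℝ] EuclideanSpace ℝ (Fin m))‖₊ : ℝ)⁻¹ - δ) *
            R')} := by
  set π := L'.toContinuousLinearMap.adjoint with hπ
  set U : Set (EuclideanSpace ℝ (Fin m) × ℝ) := {p | p.1 ∈ ball 0 R ∧ p.2 ∈ I} with hUdef
  have hU : IsOpen U := (isOpen_ball.preimage continuous_fst).inter (hI.preimage continuous_snd)
  have h1n : n ≠ 0 := by rintro rfl; exact absurd hn (by norm_num)
  -- the guard and the slice approximation
  have hC : IsC21On u {X | (X.x, X.t) ∈ U} := isC21On_of_contDiffOn hU hn hu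
  have happ : ∀ t ∈ I, ApproximatesLinearOn (fun x => π (L x + u ⟨x, t⟩))
      (T : EuclideanSpace ℝ (Fin m) →L[ℝ] EuclideanSpace ℝ (Fin m)) (ball 0 R) δ :=
    fun t ht => approximatesLinearOn_slice L L' u hC (fun x hx => ⟨hx, ht⟩)
      (T : EuclideanSpace ℝ (Fin m) →L[ℝ] EuclideanSpace ℝ (Fin m)) (hδ' t ht)
  obtain ⟨χ, u', horth, hu'def, hleft, hright, hgraph⟩ :=
    exists_regraph L L' u T hδ hR' hRR' I happ
  -- the joint map `Φ` and its partial derivative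
  set ũ : EuclideanSpace ℝ (Fin m) × ℝ → EuclideanSpace ℝ (Fin N) := fun p => u ⟨p.1, p.2⟩
    with hũ
  set Φ : EuclideanSpace ℝ (Fin m) × ℝ → EuclideanSpace ℝ (Fin m) :=
    fun p => π (L p.1 + ũ p) with hΦ
  have hΦsmooth : ContDiffOn ℝ n Φ U := by
    refine π.contDiff.comp_contDiffOn ?_
    exact (L.toContinuousLinearMap.contDiff.comp contDiff_fst).contDiffOn.add hu
  have hfderiv : ∀ p ∈ U, (fderiv ℝ Φ p).comp (ContinuousLinearMap.inl ℝ _ ℝ) =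
      π.comp (L.toContinuousLinearMap + spaceDeriv u ⟨p.1, p.2⟩) := by
    rintro ⟨x, t⟩ hp
    have hdu : DifferentiableAt ℝ ũ (x, t) := (hu.contDiffAt (hU.mem_nhds hp)).differentiableAt h1n
    have hG : HasFDerivAt (fun p : EuclideanSpace ℝ (Fin m) × ℝ => L p.1 + ũ p)
        (L.toContinuousLinearMap.comp (ContinuousLinearMap.fst ℝ _ ℝ) + fderiv ℝ ũ (x, t)) (x, t) :=
      (L.toContinuousLinearMap.hasFDerivAt.comp (x, t) hasFDerivAt_fst).add hdu.hasFDerivAt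
    have hΦ' : HasFDerivAt Φ (π.comp
        (L.toContinuousLinearMap.comp (ContinuousLinearMap.fst ℝ _ ℝ) + fderiv ℝ ũ (x, t)))
        (x, t) :=
      π.hasFDerivAt.comp (x, t) hG
    rw [hΦ'.fderiv, spaceDeriv_eq_fderiv_comp_inl hdu]
    ext1 h
    simp [hũ]
  have hinv : ∀ p ∈ U, ∃ A : EuclideanSpace ℝ (Fin m) ≃L[ℝ] EuclideanSpace ℝ (Fin m),
      (A : EuclideanSpace ℝ (Fin m) →L[ℝ] EuclideanSpace ℝ (Fin m)) =
        (fderiv ℝ Φ p).comp (ContinuousLinearMap.inl ℝ _ ℝ) := by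
    intro p hp
    set D := π.comp (L.toContinuousLinearMap + spaceDeriv u ⟨p.1, p.2⟩) with hD
    have hinj : Function.Injective D := injective_of_norm_sub_le T D (hδ' p.2 hp.2 p.1 hp.1) hδ
    have hinj' : Function.Injective (D : EuclideanSpace ℝ (Fin m) →ₗ[ℝ] EuclideanSpace ℝ (Fin m)) :=
      hinj
    refine ⟨(LinearEquiv.ofInjectiveEndo _ hinj').toContinuousLinearEquiv, ?_⟩
    rw [hfderiv p hp]
    ext1 h
    rfl
  -- regions
  set ρ : ℝ := (((‖(T.symm : EuclideanSpace ℝ (Fin m) →L[ℝ] EuclideanSpace ℝ (Fin m))‖₊ : ℝ))⁻¹ -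
    δ) * R' with hρ
  set V : Set (EuclideanSpace ℝ (Fin m) × ℝ) :=
    {q | q.2 ∈ I ∧ q.1 ∈ ball (π (L 0 + u ⟨0, q.2⟩)) ρ} with hVdef
  have hleft' : ∀ p ∈ U, (fun q : EuclideanSpace ℝ (Fin m) × ℝ => χ ⟨q.1, q.2⟩) (Φ p, p.2) = p.1 :=
    fun p hp => hleft p.2 hp.2 p.1 hp.1
  have hright' : ∀ q ∈ V, ((fun q : EuclideanSpace ℝ (Fin m) × ℝ => χ ⟨q.1, q.2⟩) q, q.2) ∈ U ∧
      Φ ((fun q : EuclideanSpace ℝ (Fin m) × ℝ => χ ⟨q.1, q.2⟩) q, q.2) = q.1 := by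
    rintro ⟨ξ, t⟩ ⟨ht, hξ⟩
    obtain ⟨hball, hΦξ⟩ := hright t ht ξ (ball_subset_closedBall hξ)
    exact ⟨⟨hball, ht⟩, hΦξ⟩
  have hχ : ContDiffOn ℝ n (fun q : EuclideanSpace ℝ (Fin m) × ℝ => χ ⟨q.1, q.2⟩) V :=
    fun q hq => (contDiffAt_sliceInverse h1n hU hΦsmooth hleft' hright' hinv hq).contDiffWithinAt
  refine ⟨χ, u', horth, hu'def, hleft, hright, hgraph, hχ, ?_⟩
  -- smoothness of `u' = G - L' (π G)`, `G q = L (χ q) + u (χ q, t)`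
  have hpair : ContDiffOn ℝ n
      (fun q : EuclideanSpace ℝ (Fin m) × ℝ => ((χ ⟨q.1, q.2⟩, q.2) : EuclideanSpace ℝ (Fin m) × ℝ))
      V := hχ.prodMk contDiffOn_snd
  have hmaps : MapsTo
      (fun q : EuclideanSpace ℝ (Fin m) × ℝ => ((χ ⟨q.1, q.2⟩, q.2) : EuclideanSpace ℝ (Fin m) × ℝ))
      V U := fun q hq => (hright' q hq).1
  have hG : ContDiffOn ℝ n
      (fun q : EuclideanSpace ℝ (Fin m) × ℝ => L (χ ⟨q.1, q.2⟩) + u ⟨χ ⟨q.1, q.2⟩, q.2⟩) V :=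
    (L.toContinuousLinearMap.contDiff.comp_contDiffOn hχ).add (hu.comp hpair hmaps)
  have hfun : (fun q : EuclideanSpace ℝ (Fin m) × ℝ => u' ⟨q.1, q.2⟩) =
      fun q => (L (χ ⟨q.1, q.2⟩) + u ⟨χ ⟨q.1, q.2⟩, q.2⟩) -
        L' (π (L (χ ⟨q.1, q.2⟩) + u ⟨χ ⟨q.1, q.2⟩, q.2⟩)) := funext fun q => hu'def _
  rw [hfun]
  exact hG.sub (L'.toContinuousLinearMap.contDiff.comp_contDiffOn (π.contDiff.comp_contDiffOn hG))

end Smooth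

end ParabolicFlow

end Literature.Geometry.Riemannian
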